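import Summits.QuantumFields.BalabanUV.T4Continuum.Support.DirichletSubregionTowerOf

/-!
# T⁴ programme, spine node NE2 (U1a), sub-row Δ1 «NE2⁰-Dirichlet» — THE PAIRING DEFECT OF A DOWNWARD-CLOSED FAMILY OF SUB-CARRIERS:
# closed form, support on the deficient indices, the bounds `‖F_k·G_k‖ ≤ γ⁻¹` (W1) and `≤ √(d·Cg·γ⁻¹)·L^{−k}` at levels with exposed
# faces (W1 + W2); the ENDs `FreeTowerLaws` / `TowerLimitRate` on the sub-carriers modulo W1–W3 and the defect majorant

Thirteenth generation of the NE2 prover lineage P1 of the cell `pub-balaban` (row NE2 owner), file 1b (owner item O13-a = O12-g′ of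
rulings R23/R24, the generic half; continuation of file 1a `Support/DirichletSubregionTowerOf`, which types the sub-carriers `pidx p k`,
the compressed averaging / pairing `QpR` / `JpR`, the PAIRING DEFECT `FpR k := √(L^d)·QpR k·JpR k − 1`, proves `J_RJ_Rᴴ = Π_{p′p′}` from
downward closure and the complement law from W1 + W2; file 2 `Support/DirichletStarVectorTower` is the instance on the crew's STAR-bond
region operator `RegionGaugeFixedVector.regionDeltaA`, leaf-07 gen 5, p223093).  THIS FILE:

 * §4 THE PAIRING DEFECT: the planted field `(J_k v)(y) = √(L^d)·L^{−d}·v(parT y)`, the forward difference entrywise, the CLOSED FORM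
   `FpR k = −√(L^d)·sel·Q·(1 − 1_{p′})·J·selᴴ` (`FpR_eq`, from the exact torus pairing `√(L^d)·Q·J = 1`); the defect only sees the
   DEFICIENT indices (those with a child outside `p′`): `‖FpR k·w‖ ≤ ‖trunc w‖` (`nsq_FpR_mulVec_le` — every factor contracts), hence
   `‖FpR k‖ ≤ 1` and **`‖FpR k·(D k)⁻¹‖ ≤ γ⁻¹`** from W1 alone (`opNorm_FpR_mul_inv_le`); and if every deficient index `i` has an
   EXPOSED FACE (`i − e_μ ∉ p k` for some `μ`: then `|w_i| = |(∇_μ ext w)(i − e_μ)|/n_k`, distinct `i` read at distinct points),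
   `n_k²·‖trunc w‖² ≤ Σ_μ ‖∇_μ ext w‖²` (`nsq_trunc_le_of_exposed`) and **`‖FpR k·(D k)⁻¹‖ ≤ √(d·Cg·γ⁻¹)·L^{−k}`** from W1 + W2 at
   level `k` (`opNorm_FpR_mul_inv_le_of_exposed`); `‖(D k)⁻¹·(FpR k)ᴴ‖` is the same number for Hermitian `D k`;
 * §5 THE ENDs **`freeTowerLaws_sub_of (hdown) (hherm) (hγ) (hCg) (hcoer) (hgrad) (hF) (hinj)`** —
   `FreeTowerLaws D (QpR p) (JpR p) (FpR p) L^d (2d√(Cg (k+1)·γ⁻¹)·L^{−k}) e₁ f` with a LEVEL-DEPENDENT W2 constant `Cg k` and a displayed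
   defect majorant `f` (dischargers §4); **`towerLimitRate_sub_of`** at any geometric rate `θ < 1` majorising the complement sequence, `f`
   and the injected law; **`towerLimitRate_sub_perturbed_of`** (the resolvent route over the sub-carriers for any compressed
   `PerturbationLaws`, `‖t‖κ < 1`).

HONEST FRAMING (T4-DAG p. 1).  `U = 1` bookkeeping ([folklore]); ONE family of sub-carriers, King's componentwise averaging, ONE
averaging scale inside `D`; finite torus; linear layer; operator norm; the three analytic inputs DISPLAYED (W2 may grow with the level
for a faithful region operator — then the complement law and the defect decay at the slower geometric rate the majorants record);
NE2 (U1a) NOT proved; spine 0/9 unchanged; NOT [B9] (3.23)–(3.27) as printed; NOT infinite volume, NOT a mass gap, NOT the Clay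
problem, NOT summit progress.  HONEST DEPENDENCY: continuum YM on T⁴ ⇐ BetaPertH ∧ nine spine estimates (0/9 proved); BetaPertH ⇐
(D1) ∧ (D4) ∧ CAP+tail; G-an2-4 gates asym, D1 and NE2/3/4.  No `sorry`.
-/

noncomputable section

open scoped BigOperators ComplexConjugate Matrix Matrix.Norms.L2Operator
open Filter Topology

namespace Summit.QuantumFields.BalabanUV.T4Continuum.DirichletSubregionTowerOf

open Literature.MathematicalPhysics.QuantumFieldTheory.Balaban1983to89.B5Prop11Plancherel (Cst Cst_nonneg Tor fine fdiff shiftM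
  unitVec opNorm_le_of_sq_le)
open Literature.MathematicalPhysics.QuantumFieldTheory.Balaban1983to89.B5Prop11Lower (nsq nsq_nonneg norm_star_dotProduct_le nsq_mulVec_le)
open Literature.MathematicalPhysics.QuantumFieldTheory.Balaban1983to89.B5G183RateUnitTower (lev lev_neZero)
open Summit.QuantumFields.BalabanUV.T4Continuum
open Summit.QuantumFields.BalabanUV.T4Continuum.CovariantAveragingTower (TowerLimitRate)
open Summit.QuantumFields.BalabanUV.T4Continuum.BalabanAveragedTowerUnit (idx Qlev one_le_lev' cast_lev' opNorm_Qlev_sq_le)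
open Summit.QuantumFields.BalabanUV.T4Continuum.BalabanBlockPoincare (Pi opNorm_one_sub_Pi_mul_le opNorm_shiftM_sub_one_mul_le
  nsq_mulVec_le_rect nsq_Qavg_mulVec_le)
open Summit.QuantumFields.BalabanUV.T4Continuum.BackgroundResolventTower
open Summit.QuantumFields.BalabanUV.T4Continuum.KingPairingPlantedLaw (JK JpcT JpcT_eq_JK opNorm_JpcT_le sqrt_smul_Qlev_mul_JpcT)
open Summit.QuantumFields.BalabanUV.T4Continuum.BlockPairingGeometry (parT JK_apply)
open Summit.QuantumFields.BalabanUV.T4Continuum.SubtypeCompression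
open Summit.QuantumFields.BalabanUV.T4Continuum.DirichletRegionTower (PiT PiT_conjTranspose JpcT_mul_conjTranspose JpcT_apply_eq_zero)
open Summit.QuantumFields.BalabanUV.T4Continuum.DirichletRegionTowerOf (complementConst_nonneg)
open Summit.QuantumFields.BalabanUV.T4Continuum.PerturbationAlgebra (perturbationLaws_zero)

variable {d : ℕ} (L : ℕ) [NeZero L] (M : Fin d → ℕ) [hM : ∀ μ, NeZero (M μ)]
variable (p : (k : ℕ) → idx L M k → Prop) [hp : ∀ k, DecidablePred (p k)]

/-! ## §4 The pairing defect: algebraic form, support on the deficient indices, and its two bounds -/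

section Defect

variable (D : (k : ℕ) → Matrix (pidx L M p k) (pidx L M p k) ℂ) (k : ℕ)

/-- the planted field: `(J_k v)(y) = √(L^d)·L^{−d}·v(parT y)`. [cite: King1986, p.664 (shape)] [folklore] -/
theorem JpcT_mulVec_apply (v : idx L M k → ℂ) (y : idx L M (k + 1)) :
    (JpcT L M k *ᵥ v) y = (((Real.sqrt ((L : ℝ) ^ d)) : ℝ) : ℂ) * ((((L : ℂ) ^ d))⁻¹ * v (parT (lev L k) L M y)) := by
  simp only [Matrix.mulVec, dotProduct, JpcT_eq_JK, JK_apply, mul_ite, mul_one, mul_zero, ite_mul, zero_mul]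
  rw [Finset.sum_ite_eq, if_pos (Finset.mem_univ _), mul_assoc]

/-- the forward difference, entrywise: `(∇_μ v)(z) = c·(v(z + e_μ) − v(z))`. [cite: Balaban1984PropagatorsI, (1.31) p.23 (shape)] [folklore] -/
theorem fdiff_mulVec_apply {N : Fin d → ℕ} [∀ μ, NeZero (N μ)] (c : ℂ) (μ : Fin d) (v : Tor N × Fin d → ℂ) (z : Tor N × Fin d) :
    (fdiff N c μ *ᵥ v) z = c * (v (z.1 + unitVec N μ, z.2) - v z) := by
  simp only [fdiff, Matrix.smul_mulVec, Pi.smul_apply, smul_eq_mul, Matrix.sub_mulVec, Matrix.one_mulVec, Pi.sub_apply]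
  congr 1
  simp only [Matrix.mulVec, dotProduct, shiftM, ite_mul, one_mul, zero_mul]
  rw [Finset.sum_ite_eq' Finset.univ (z.1 + unitVec N μ, z.2), if_pos (Finset.mem_univ _)]

/-- **THE DEFECT IN CLOSED FORM**: `FpR k = −√(L^d)·sel·Q·(1 − 1_{p′})·J·selᴴ`. [folklore] -/
theorem FpR_eq : FpR L M p k
    = -((((Real.sqrt ((L : ℝ) ^ d)) : ℝ) : ℂ)) •
        (sel (p k) * (Qlev L M k * (1 - (sel (p (k + 1)))ᴴ * sel (p (k + 1))) * JpcT L M k) * (sel (p k))ᴴ) := by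
  have h0 : ((((Real.sqrt ((L : ℝ) ^ d)) : ℝ) : ℂ)) • (Qlev L M k * JpcT L M k) = 1 := by
    rw [sqrt_smul_Qlev_mul_JpcT, add_zero]
  have h1 : ((((Real.sqrt ((L : ℝ) ^ d)) : ℝ) : ℂ)) • (sel (p k) * (Qlev L M k * JpcT L M k) * (sel (p k))ᴴ) = 1 := by
    rw [← Matrix.smul_mul, ← Matrix.mul_smul, h0, Matrix.mul_one, sel_mul_sel_conjTranspose]
  unfold FpR QpR JpR
  rw [toBlock_eq_sel, toBlock_eq_sel, neg_smul, Matrix.mul_sub, Matrix.mul_one, Matrix.sub_mul, Matrix.mul_sub,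
    Matrix.sub_mul, smul_sub, h1, neg_sub]
  congr 2
  simp only [Matrix.mul_assoc]

/-- THE DEFICIENT INDICES: a `p k`-index with a child outside `p (k+1)`; the TRUNCATION of a field to them. [folklore] -/
def trunc (w : pidx L M p k → ℂ) : pidx L M p k → ℂ := fun i =>
  if ∃ y : idx L M (k + 1), parT (lev L k) L M y = i.1 ∧ ¬ p (k + 1) y then w i else 0

/-- `‖trunc w‖² ≤ ‖w‖²`. [folklore] -/
theorem nsq_trunc_le (w : pidx L M p k → ℂ) : nsq (trunc L M p k w) ≤ nsq w := by
  unfold nsq trunc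
  refine Finset.sum_le_sum fun i _ => ?_
  split_ifs
  · exact le_rfl
  · rw [norm_zero, zero_pow two_ne_zero]; positivity

/-- the defect's inner factor only sees the deficient indices: off `p′`, the planted extension of `w` is that of `trunc w`. [folklore] -/
theorem indicator_plant_ext_eq (w : pidx L M p k → ℂ) :
    (1 - (sel (p (k + 1)))ᴴ * sel (p (k + 1))) *ᵥ (JpcT L M k *ᵥ ext (p k) w)
      = (1 - (sel (p (k + 1)))ᴴ * sel (p (k + 1))) *ᵥ (JpcT L M k *ᵥ ext (p k) (trunc L M p k w)) := by
  funext y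
  rw [Matrix.sub_mulVec, Matrix.sub_mulVec, Pi.sub_apply, Pi.sub_apply, Matrix.one_mulVec, Matrix.one_mulVec,
    sel_conjTranspose_mul_sel_mulVec, sel_conjTranspose_mul_sel_mulVec]
  by_cases hy : p (k + 1) y
  · rw [if_pos hy, if_pos hy, sub_self, sub_self]
  · rw [if_neg hy, if_neg hy, sub_zero, sub_zero, JpcT_mulVec_apply, JpcT_mulVec_apply]
    congr 2
    by_cases hi : p k (parT (lev L k) L M y)
    · have e1 := ext_apply_of (p k) w ⟨parT (lev L k) L M y, hi⟩
      have e2 := ext_apply_of (p k) (trunc L M p k w) ⟨parT (lev L k) L M y, hi⟩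
      simp only at e1 e2
      rw [e1, e2, trunc, if_pos ⟨y, rfl, hy⟩]
    · rw [ext_apply_of_not _ _ hi, ext_apply_of_not _ _ hi]

/-- **`‖FpR k·w‖ ≤ ‖trunc w‖`**: the defect is supported on the deficient indices and contracts there. [folklore] -/
theorem nsq_FpR_mulVec_le (w : pidx L M p k → ℂ) : nsq (FpR L M p k *ᵥ w) ≤ nsq (trunc L M p k w) := by
  have hr : (0 : ℝ) < (L : ℝ) ^ d := pow_pos (by exact_mod_cast Nat.pos_of_ne_zero (NeZero.ne L)) d
  have e1 : FpR L M p k *ᵥ w = -(((((Real.sqrt ((L : ℝ) ^ d)) : ℝ) : ℂ)) • (sel (p k) *ᵥ (Qlev L M k *ᵥ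
      ((1 - (sel (p (k + 1)))ᴴ * sel (p (k + 1))) *ᵥ (JpcT L M k *ᵥ ext (p k) (trunc L M p k w)))))) := by
    rw [FpR_eq, Matrix.smul_mulVec, neg_smul, ← Matrix.mulVec_mulVec, ← Matrix.mulVec_mulVec, ← Matrix.mulVec_mulVec,
      ← Matrix.mulVec_mulVec, sel_conjTranspose_mulVec, indicator_plant_ext_eq]
  -- each factor contracts
  have hnn : ∀ v : idx L M (k + 1) → ℂ, nsq ((1 - (sel (p (k + 1)))ᴴ * sel (p (k + 1))) *ᵥ v) ≤ nsq v := by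
    intro v
    unfold nsq
    refine Finset.sum_le_sum fun y _ => ?_
    rw [Matrix.sub_mulVec, Pi.sub_apply, Matrix.one_mulVec, sel_conjTranspose_mul_sel_mulVec]
    split_ifs
    · rw [sub_self, norm_zero, zero_pow two_ne_zero]; positivity
    · rw [sub_zero]
  have hneg : ∀ v : pidx L M p k → ℂ, nsq (-v) = nsq v := fun v => by simp [nsq]
  have hsmul : ∀ (c : ℂ) (v : pidx L M p k → ℂ), nsq (c • v) = ‖c‖ ^ 2 * nsq v := fun c v => by
    simp only [nsq, Pi.smul_apply, smul_eq_mul, norm_mul, mul_pow, Finset.mul_sum]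
  have hcc : ‖((((Real.sqrt ((L : ℝ) ^ d)) : ℝ) : ℂ))‖ ^ 2 = (L : ℝ) ^ d := by
    rw [Complex.norm_real, Real.norm_of_nonneg (Real.sqrt_nonneg _), Real.sq_sqrt hr.le]
  have hsel : ∀ v : idx L M k → ℂ, nsq (sel (p k) *ᵥ v) ≤ nsq v := by
    intro v
    rw [sel_mulVec]; unfold nsq
    rw [← Fintype.sum_subtype_add_sum_subtype (p k) (fun i => ‖v i‖ ^ 2)]
    exact le_add_of_nonneg_right (Finset.sum_nonneg fun _ _ => by positivity)
  have hJ : ‖JpcT L M k‖ ≤ 1 := opNorm_JpcT_le L M k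
  set u := (1 - (sel (p (k + 1)))ᴴ * sel (p (k + 1))) *ᵥ (JpcT L M k *ᵥ ext (p k) (trunc L M p k w)) with hu
  rw [e1, hneg, hsmul, hcc]
  calc (L : ℝ) ^ d * nsq (sel (p k) *ᵥ (Qlev L M k *ᵥ u)) ≤ (L : ℝ) ^ d * nsq (Qlev L M k *ᵥ u) :=
        mul_le_mul_of_nonneg_left (hsel _) hr.le
    _ ≤ (L : ℝ) ^ d * ((((L : ℝ) ^ d))⁻¹ * nsq u) := mul_le_mul_of_nonneg_left (nsq_Qavg_mulVec_le (lev L k) L M u) hr.le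
    _ = nsq u := by rw [← mul_assoc, mul_inv_cancel₀ hr.ne', one_mul]
    _ ≤ nsq (JpcT L M k *ᵥ ext (p k) (trunc L M p k w)) := by rw [hu]; exact hnn _
    _ ≤ ‖JpcT L M k‖ ^ 2 * nsq (ext (p k) (trunc L M p k w)) := nsq_mulVec_le_rect _ _
    _ ≤ 1 * nsq (ext (p k) (trunc L M p k w)) :=
        mul_le_mul_of_nonneg_right (pow_le_one₀ (norm_nonneg _) hJ) (nsq_nonneg _)
    _ = nsq (trunc L M p k w) := by rw [one_mul, nsq_ext]

/-- `‖FpR k‖ ≤ 1`. [folklore] -/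
theorem opNorm_FpR_le : ‖FpR L M p k‖ ≤ 1 := by
  refine opNorm_le_of_sq_le _ zero_le_one fun y => ?_
  have e1 : ∑ i, ‖∑ j, FpR L M p k i j * y j‖ ^ 2 = nsq (FpR L M p k *ᵥ y) := rfl
  have e2 : ∑ j, ‖y j‖ ^ 2 = nsq y := rfl
  rw [e1, e2, one_pow, one_mul]
  exact (nsq_FpR_mulVec_le L M p k y).trans (nsq_trunc_le L M p k y)

/-- **THE CRUDE DEFECT BOUND from W1 alone**: `‖FpR k·(D k)⁻¹‖ ≤ γ⁻¹`. [folklore] -/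
theorem opNorm_FpR_mul_inv_le {γ : ℝ} (hγ : 0 < γ) (hcoer : Coercive (D k) γ) : ‖FpR L M p k * (D k)⁻¹‖ ≤ γ⁻¹ :=
  calc ‖FpR L M p k * (D k)⁻¹‖ ≤ ‖FpR L M p k‖ * ‖(D k)⁻¹‖ := Matrix.l2_opNorm_mul _ _
    _ ≤ 1 * γ⁻¹ := mul_le_mul (opNorm_FpR_le L M p k) (opNorm_inv_le_of_coercive hγ hcoer) (norm_nonneg _) zero_le_one
    _ = γ⁻¹ := one_mul _

/-- the left defect is the same number for a Hermitian operator: `‖(D k)⁻¹·(FpR k)ᴴ‖ = ‖FpR k·(D k)⁻¹‖`. [folklore] -/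
theorem opNorm_inv_mul_FpR_conjTranspose (hherm : (D k).IsHermitian) :
    ‖(D k)⁻¹ * (FpR L M p k)ᴴ‖ = ‖FpR L M p k * (D k)⁻¹‖ := by
  rw [← Matrix.l2_opNorm_conjTranspose ((D k)⁻¹ * (FpR L M p k)ᴴ), Matrix.conjTranspose_mul,
    Matrix.conjTranspose_conjTranspose, hherm.inv.eq]

/-- **EXPOSED FACES CONTROL THE DEFICIENT MASS BY THE GRADIENTS OF THE ZERO-EXTENSION**: if every deficient index `i` has a
direction `μ` with `i − e_μ ∉ p k`, then `n_k²·‖trunc w‖² ≤ Σ_μ ‖∇_μ ext w‖²` (`|w_i| = |(∇_μ ext w)(i − e_μ)|/n_k`). [folklore] -/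
theorem nsq_trunc_le_of_exposed
    (hexp : ∀ i : pidx L M p k, (∃ y : idx L M (k + 1), parT (lev L k) L M y = i.1 ∧ ¬ p (k + 1) y) →
      ∃ μ : Fin d, ¬ p k (i.1.1 - unitVec (fine (lev L k) M) μ, i.1.2))
    (w : pidx L M p k → ℂ) :
    ((L : ℝ) ^ k) ^ 2 * nsq (trunc L M p k w)
      ≤ ∑ μ, nsq (fdiff (fine (lev L k) M) ((lev L k : ℕ) : ℂ) μ *ᵥ ext (p k) w) := by
  set n := lev L k with hn
  set c : ℂ := ((n : ℕ) : ℂ) with hc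
  have hcn : ‖c‖ ^ 2 = ((L : ℝ) ^ k) ^ 2 := by rw [hc, Complex.norm_natCast, hn, cast_lev']
  -- the predecessor map in direction `μ`
  let φ : Fin d → pidx L M p k → idx L M k := fun μ i => (i.1.1 - unitVec (fine n M) μ, i.1.2)
  have hφ : ∀ μ, Function.Injective (φ μ) := by
    intro μ i j h
    apply Subtype.ext
    have h1 : (φ μ i).1 = (φ μ j).1 := congrArg Prod.fst h
    have h2 : (φ μ i).2 = (φ μ j).2 := congrArg Prod.snd h
    exact Prod.ext (sub_left_injective h1) h2
  -- at an exposed predecessor the difference is the value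
  have hval : ∀ μ (i : pidx L M p k), ¬ p k (φ μ i) →
      (fdiff (fine n M) c μ *ᵥ ext (p k) w) (φ μ i) = c * w i := by
    intro μ i hi
    rw [fdiff_mulVec_apply, ext_apply_of_not _ _ hi, sub_zero]
    have e : ((φ μ i).1 + unitVec (fine n M) μ, (φ μ i).2) = i.1 := by
      show (i.1.1 - unitVec (fine n M) μ + unitVec (fine n M) μ, i.1.2) = i.1
      rw [sub_add_cancel]
    rw [e, ext_apply_of]
  -- step 1: pointwise domination of the truncation by the exposed-face indicators
  have step1 : ((L : ℝ) ^ k) ^ 2 * nsq (trunc L M p k w)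
      ≤ ∑ μ, ∑ i : pidx L M p k, if p k (φ μ i) then 0 else ‖c‖ ^ 2 * ‖w i‖ ^ 2 := by
    rw [Finset.sum_comm, nsq, Finset.mul_sum]
    refine Finset.sum_le_sum fun i _ => ?_
    unfold trunc
    split_ifs with hdef
    · obtain ⟨μ, hμ⟩ := hexp i hdef
      rw [← hcn]
      calc ‖c‖ ^ 2 * ‖w i‖ ^ 2 = (if p k (φ μ i) then 0 else ‖c‖ ^ 2 * ‖w i‖ ^ 2) := by rw [if_neg hμ]
        _ ≤ ∑ ν, (if p k (φ ν i) then 0 else ‖c‖ ^ 2 * ‖w i‖ ^ 2) :=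
            Finset.single_le_sum (f := fun ν => if p k (φ ν i) then (0 : ℝ) else ‖c‖ ^ 2 * ‖w i‖ ^ 2)
              (fun ν _ => by split_ifs <;> positivity) (Finset.mem_univ μ)
    · rw [norm_zero, zero_pow two_ne_zero, mul_zero]
      exact Finset.sum_nonneg fun ν _ => by split_ifs <;> positivity
  refine step1.trans (Finset.sum_le_sum fun μ _ => ?_)
  -- step 2: for each direction, the exposed terms are values of `∇_μ ext w` at distinct points
  have step2 : ∑ i : pidx L M p k, (if p k (φ μ i) then 0 else ‖c‖ ^ 2 * ‖w i‖ ^ 2)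
      ≤ ∑ i : pidx L M p k, ‖(fdiff (fine n M) c μ *ᵥ ext (p k) w) (φ μ i)‖ ^ 2 := by
    refine Finset.sum_le_sum fun i _ => ?_
    split_ifs with hi
    · positivity
    · rw [hval μ i hi, norm_mul, mul_pow]
  refine step2.trans ?_
  rw [nsq, ← Finset.sum_image (f := fun z => ‖(fdiff (fine n M) c μ *ᵥ ext (p k) w) z‖ ^ 2)
    (fun i _ j _ h => hφ μ h)]
  exact Finset.sum_le_sum_of_subset_of_nonneg (Finset.subset_univ _) fun z _ _ => by positivity

/-- **THE DEFECT BOUND from W1 + W2 AT A LEVEL WITH EXPOSED FACES**: `‖FpR k·(D k)⁻¹‖ ≤ √(d·Cg·γ⁻¹)·L^{−k}`. [folklore] -/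
theorem opNorm_FpR_mul_inv_le_of_exposed {γ Cg : ℝ} (hγ : 0 < γ) (hCg : 0 ≤ Cg) (hcoer : Coercive (D k) γ)
    (hgrad : ∀ (ν : Fin d) (w : pidx L M p k → ℂ),
      nsq (fdiff (fine (lev L k) M) ((lev L k : ℕ) : ℂ) ν *ᵥ ext (p k) w) ≤ Cg * (star w ⬝ᵥ (D k *ᵥ w)).re)
    (hexp : ∀ i : pidx L M p k, (∃ y : idx L M (k + 1), parT (lev L k) L M y = i.1 ∧ ¬ p (k + 1) y) →
      ∃ μ : Fin d, ¬ p k (i.1.1 - unitVec (fine (lev L k) M) μ, i.1.2)) :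
    ‖FpR L M p k * (D k)⁻¹‖ ≤ Real.sqrt (d * Cg * γ⁻¹) * ((L : ℝ) ^ k)⁻¹ := by
  set Dk := D k with hDk
  have hU : IsUnit Dk.det := isUnit_det_of_coercive hγ hcoer
  have hG : ‖Dk⁻¹‖ ≤ γ⁻¹ := opNorm_inv_le_of_coercive hγ hcoer
  have hLk : (0 : ℝ) < (L : ℝ) ^ k := pow_pos (by exact_mod_cast Nat.pos_of_ne_zero (NeZero.ne L)) k
  have hK : 0 ≤ Real.sqrt (d * Cg * γ⁻¹) * ((L : ℝ) ^ k)⁻¹ := by positivity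
  refine opNorm_le_of_sq_le _ hK fun y => ?_
  set v : pidx L M p k → ℂ := Dk⁻¹ *ᵥ y with hv
  have e1 : ∑ i, ‖∑ j, (FpR L M p k * Dk⁻¹) i j * y j‖ ^ 2 = nsq (FpR L M p k *ᵥ v) := by
    rw [hv, Matrix.mulVec_mulVec]; rfl
  have e2 : ∑ j, ‖y j‖ ^ 2 = nsq y := rfl
  rw [e1, e2]
  have hDv : Dk *ᵥ v = y := by
    rw [hv, Matrix.mulVec_mulVec, Matrix.mul_nonsing_inv _ hU, Matrix.one_mulVec]
  -- the form of `v` against `D v = y`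
  have hform : (star v ⬝ᵥ (Dk *ᵥ v)).re ≤ γ⁻¹ * nsq y := by
    rw [hDv]
    have h3 : (star v ⬝ᵥ y).re ≤ Real.sqrt (nsq v) * Real.sqrt (nsq y) :=
      (Complex.re_le_norm _).trans (norm_star_dotProduct_le v y)
    have h4 : nsq v ≤ γ⁻¹ ^ 2 * nsq y :=
      (nsq_mulVec_le Dk⁻¹ y).trans (mul_le_mul_of_nonneg_right (pow_le_pow_left₀ (norm_nonneg _) hG 2) (nsq_nonneg _))
    have h5 : Real.sqrt (nsq v) ≤ γ⁻¹ * Real.sqrt (nsq y) := by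
      rw [← Real.sqrt_sq (inv_nonneg.mpr hγ.le), ← Real.sqrt_mul (sq_nonneg _)]
      exact Real.sqrt_le_sqrt h4
    have hsy : Real.sqrt (nsq y) * Real.sqrt (nsq y) = nsq y := Real.mul_self_sqrt (nsq_nonneg _)
    calc (star v ⬝ᵥ y).re ≤ Real.sqrt (nsq v) * Real.sqrt (nsq y) := h3
      _ ≤ γ⁻¹ * Real.sqrt (nsq y) * Real.sqrt (nsq y) := mul_le_mul_of_nonneg_right h5 (Real.sqrt_nonneg _)
      _ = γ⁻¹ * nsq y := by rw [mul_assoc, hsy]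
  -- the chain
  have hsum : ∑ μ, nsq (fdiff (fine (lev L k) M) ((lev L k : ℕ) : ℂ) μ *ᵥ ext (p k) v) ≤ d * Cg * (γ⁻¹ * nsq y) :=
    calc ∑ μ, nsq (fdiff (fine (lev L k) M) ((lev L k : ℕ) : ℂ) μ *ᵥ ext (p k) v)
        ≤ ∑ _μ : Fin d, Cg * (star v ⬝ᵥ (Dk *ᵥ v)).re := Finset.sum_le_sum fun μ _ => hgrad μ v
      _ = d * (Cg * (star v ⬝ᵥ (Dk *ᵥ v)).re) := by rw [Finset.sum_const, Finset.card_univ, Fintype.card_fin, nsmul_eq_mul]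
      _ ≤ d * (Cg * (γ⁻¹ * nsq y)) := mul_le_mul_of_nonneg_left (mul_le_mul_of_nonneg_left hform hCg) (Nat.cast_nonneg d)
      _ = d * Cg * (γ⁻¹ * nsq y) := by ring
  have hmain : ((L : ℝ) ^ k) ^ 2 * nsq (FpR L M p k *ᵥ v) ≤ d * Cg * (γ⁻¹ * nsq y) :=
    calc ((L : ℝ) ^ k) ^ 2 * nsq (FpR L M p k *ᵥ v) ≤ ((L : ℝ) ^ k) ^ 2 * nsq (trunc L M p k v) :=
          mul_le_mul_of_nonneg_left (nsq_FpR_mulVec_le L M p k v) (sq_nonneg _)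
      _ ≤ ∑ μ, nsq (fdiff (fine (lev L k) M) ((lev L k : ℕ) : ℂ) μ *ᵥ ext (p k) v) := nsq_trunc_le_of_exposed L M p k hexp v
      _ ≤ d * Cg * (γ⁻¹ * nsq y) := hsum
  have hsq : (Real.sqrt (d * Cg * γ⁻¹) * ((L : ℝ) ^ k)⁻¹) ^ 2 = d * Cg * γ⁻¹ * (((L : ℝ) ^ k) ^ 2)⁻¹ := by
    rw [mul_pow, Real.sq_sqrt (by positivity), inv_pow]
  rw [hsq]
  have hL2 : (0 : ℝ) < ((L : ℝ) ^ k) ^ 2 := pow_pos hLk 2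
  calc nsq (FpR L M p k *ᵥ v) = (((L : ℝ) ^ k) ^ 2)⁻¹ * (((L : ℝ) ^ k) ^ 2 * nsq (FpR L M p k *ᵥ v)) := by
        rw [← mul_assoc, inv_mul_cancel₀ hL2.ne', one_mul]
    _ ≤ (((L : ℝ) ^ k) ^ 2)⁻¹ * (d * Cg * (γ⁻¹ * nsq y)) := mul_le_mul_of_nonneg_left hmain (inv_nonneg.mpr hL2.le)
    _ = d * Cg * γ⁻¹ * (((L : ℝ) ^ k) ^ 2)⁻¹ * nsq y := by ring

end Defect

/-! ## §5 The ENDs: `FreeTowerLaws` and convergence on downward-closed sub-carriers, modulo W1–W3 and the defect majorant -/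

section End

variable (D : (k : ℕ) → Matrix (pidx L M p k) (pidx L M p k) ℂ)

/-- **THE Ω-RESTRICTED FREE TOWER LAWS ON DOWNWARD-CLOSED SUB-CARRIERS, MODULO W1–W3**: W2 with a level-dependent constant `Cg k`,
the pairing defect bounded by a displayed sequence `f` (dischargers: `opNorm_FpR_mul_inv_le` — always `γ⁻¹`;
`opNorm_FpR_mul_inv_le_of_exposed` — `√(d·Cg k·γ⁻¹)·L^{−k}` at levels with exposed faces). [folklore] -/
theorem freeTowerLaws_sub_of (hdown : ∀ (k : ℕ) (y : idx L M (k + 1)), p (k + 1) y → p k (parT (lev L k) L M y))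
    (hherm : ∀ k, (D k).IsHermitian) {γ : ℝ} {Cg : ℕ → ℝ} (hγ : 0 < γ) (hCg : ∀ k, 0 ≤ Cg k)
    (hcoer : ∀ k, Coercive (D k) γ)
    (hgrad : ∀ (k : ℕ) (ν : Fin d) (w : pidx L M p k → ℂ),
      nsq (fdiff (fine (lev L k) M) ((lev L k : ℕ) : ℂ) ν *ᵥ ext (p k) w) ≤ Cg k * (star w ⬝ᵥ (D k *ᵥ w)).re)
    {f : ℕ → ℝ} (hF : ∀ k, ‖FpR L M p k * (D k)⁻¹‖ ≤ f k)
    {e₁ : ℕ → ℝ} (hinj : ∀ k, ‖(D (k + 1))⁻¹ * JpR L M p k - JpR L M p k * (D k)⁻¹‖ ≤ e₁ k) :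
    FreeTowerLaws D (QpR L M p) (JpR L M p) (FpR L M p) ((L : ℝ) ^ d)
      (fun k => 2 * d * Real.sqrt (Cg (k + 1) * γ⁻¹) * ((L : ℝ)⁻¹) ^ k) e₁ f where
  isUnit_det := fun k => isUnit_det_of_coercive hγ (hcoer k)
  opNorm_A_sq_le := opNorm_QpR_sq_le L M p
  opNorm_J_le := opNorm_JpR_le L M p
  A_mul_J := sqrt_smul_QpR_mul_JpR L M p
  opNorm_F_mul_inv_le := hF
  opNorm_inv_mul_F_le := fun k => by rw [opNorm_inv_mul_FpR_conjTranspose L M p D k (hherm k)]; exact hF k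
  complement_le := fun k =>
    complement_le_sub_of L M p D k hdown (hherm (k + 1)) hγ (hCg (k + 1)) (hcoer (k + 1)) (hgrad (k + 1))
  injected_le := hinj

/-- **CONVERGENCE ON DOWNWARD-CLOSED SUB-CARRIERS MODULO W1–W3 AT ANY GEOMETRIC RATE `θ < 1`** majorising the complement sequence,
the defect sequence and the injected law. [folklore] -/
theorem towerLimitRate_sub_of (hdown : ∀ (k : ℕ) (y : idx L M (k + 1)), p (k + 1) y → p k (parT (lev L k) L M y))
    (hherm : ∀ k, (D k).IsHermitian) {γ : ℝ} {Cg : ℕ → ℝ} (hγ : 0 < γ) (hCg : ∀ k, 0 ≤ Cg k)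
    (hcoer : ∀ k, Coercive (D k) γ)
    (hgrad : ∀ (k : ℕ) (ν : Fin d) (w : pidx L M p k → ℂ),
      nsq (fdiff (fine (lev L k) M) ((lev L k : ℕ) : ℂ) ν *ᵥ ext (p k) w) ≤ Cg k * (star w ⬝ᵥ (D k *ᵥ w)).re)
    {f : ℕ → ℝ} (hF : ∀ k, ‖FpR L M p k * (D k)⁻¹‖ ≤ f k)
    {θ C₀ C₁ Cf : ℝ} (hθ1 : θ < 1)
    (h₀ : ∀ k, 2 * d * Real.sqrt (Cg (k + 1) * γ⁻¹) * ((L : ℝ)⁻¹) ^ k ≤ C₀ * θ ^ k) (hf : ∀ k, f k ≤ Cf * θ ^ k)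
    (hinj : ∀ k, ‖(D (k + 1))⁻¹ * JpR L M p k - JpR L M p k * (D k)⁻¹‖ ≤ C₁ * θ ^ k) :
    TowerLimitRate (QpR L M p) ((L : ℝ) ^ d) (fun k => (D k)⁻¹) (Cpert 0 C₀ C₁ 0 Cf 0) θ := by
  have hr : (0 : ℝ) < (L : ℝ) ^ d := pow_pos (by exact_mod_cast Nat.pos_of_ne_zero (NeZero.ne L)) d
  have ht : ‖(0 : ℂ)‖ * 0 < 1 := by rw [norm_zero, zero_mul]; exact one_pos
  have h := towerLimitRate_perturbed hr (freeTowerLaws_sub_of L M p D hdown hherm hγ hCg hcoer hgrad hF hinj)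
    (perturbationLaws_zero (D := D) (J := JpR L M p)) hθ1 h₀ (fun k => le_rfl) (fun k => by rw [zero_mul]) hf ht
  simp only [zero_smul, add_zero] at h
  exact h

/-- **THE RESOLVENT ROUTE OVER THE SUB-CARRIERS** (modulo W1–W3 and the defect majorant): any compressed perturbation family with
`PerturbationLaws D P (JpR p) κ (k ↦ C₂θ^k)`, any `‖t‖κ < 1`. [folklore] -/
theorem towerLimitRate_sub_perturbed_of
    (hdown : ∀ (k : ℕ) (y : idx L M (k + 1)), p (k + 1) y → p k (parT (lev L k) L M y))
    (hherm : ∀ k, (D k).IsHermitian) {γ : ℝ} {Cg : ℕ → ℝ} (hγ : 0 < γ) (hCg : ∀ k, 0 ≤ Cg k)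
    (hcoer : ∀ k, Coercive (D k) γ)
    (hgrad : ∀ (k : ℕ) (ν : Fin d) (w : pidx L M p k → ℂ),
      nsq (fdiff (fine (lev L k) M) ((lev L k : ℕ) : ℂ) ν *ᵥ ext (p k) w) ≤ Cg k * (star w ⬝ᵥ (D k *ᵥ w)).re)
    {f : ℕ → ℝ} (hF : ∀ k, ‖FpR L M p k * (D k)⁻¹‖ ≤ f k)
    {θ C₀ C₁ Cf : ℝ} (hθ1 : θ < 1)
    (h₀ : ∀ k, 2 * d * Real.sqrt (Cg (k + 1) * γ⁻¹) * ((L : ℝ)⁻¹) ^ k ≤ C₀ * θ ^ k) (hf : ∀ k, f k ≤ Cf * θ ^ k)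
    (hinj : ∀ k, ‖(D (k + 1))⁻¹ * JpR L M p k - JpR L M p k * (D k)⁻¹‖ ≤ C₁ * θ ^ k)
    {P : (k : ℕ) → Matrix (pidx L M p k) (pidx L M p k) ℂ} {κ C₂ : ℝ}
    (hpert : PerturbationLaws D P (JpR L M p) κ (fun k => C₂ * θ ^ k)) {t : ℂ} (ht : ‖t‖ * κ < 1) :
    TowerLimitRate (QpR L M p) ((L : ℝ) ^ d) (fun k => (D k + t • P k)⁻¹) (Cpert κ C₀ C₁ C₂ Cf t) θ := by
  have hr : (0 : ℝ) < (L : ℝ) ^ d := pow_pos (by exact_mod_cast Nat.pos_of_ne_zero (NeZero.ne L)) d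
  exact towerLimitRate_perturbed hr (freeTowerLaws_sub_of L M p D hdown hherm hγ hCg hcoer hgrad hF hinj) hpert hθ1
    h₀ (fun k => le_rfl) (fun k => le_rfl) hf ht

end End

end Summit.QuantumFields.BalabanUV.T4Continuum.DirichletSubregionTowerOf

end
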